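import Mathlib.RepresentationTheory.Continuous.Basic
import Mathlib.RepresentationTheory.Submodule
import Mathlib.RepresentationTheory.Coinvariants
import Mathlib.LinearAlgebra.FreeModule.Basic
import Mathlib.RingTheory.Finiteness.Defs
import HarnessLib

/-!
# [AbsTopI] Lemma 2.7 ("Combinatorial Quotients of Tate Modules") over Mathlib's continuous representations

S. Mochizuki, *Topics in Absolute Anabelian Geometry I: Generalities*, J. Math. Sci. Univ. Tokyo **19**
(2012) [AbsTopI] (manuscript `paper:url-11ac98ba15fc`, cell render p0024 l.-12 – p0025 l.6), Lemma 2.7: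

> "Suppose that `k` is an MLF.  Let `B` be a semi-abelian variety over `k`.  Write `T(B) := Hom(ℚ/ℤ, B(k̄))`
> for the Tate module of `B`.  Then: (i) The maximal torsion-free quotient module `T(B) ↠ Q` of `T(B)` on
> which `G_k` acts trivially is a finitely generated free `Ẑ`-module.  (ii) There exists a quotient
> `G_k`-module `T(B) ↠ R` such that the following properties hold: (a) `R` is a finitely generated free
> `Ẑ`-module; (b) the action of `G_k` on `R` factors through a finite quotient; (c) no nonzero torsion-free
> subquotient `S` of the `G_k`-module `N := Ker(T(B) ↠ R)` satisfies the property that the resulting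
> action of `G_k` on `S` factors through a finite quotient.  (iii) If `R` is as in (ii), then the natural
> map `H¹(G_k, Hom(R, Ẑ)) → H¹(G_k, Hom(T(B), Ẑ))` is injective."
> Proof of (iii) (p. 25): "by considering the long exact cohomology sequence associated to
> `0 → Hom(R, Ẑ) → Hom(T(B), Ẑ) → Hom(N, Ẑ) → 0`, since the fact that `N` has no nonzero torsion-free
> subquotients on which `G_k` acts through a finite quotient implies that `H⁰(G_k, Hom(N, Ẑ)) = 0`."

abc-iut cell, layer L4, row «LEM27iii-MODULE» (abc-iut-L4-lead 12:02:17Z GO (a)), seat abc-iut-w5-d058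
(gen 8); v2 after review of p444481 (CONVENTIONS §4: Mathlib's vocabulary).  MODULE-LEVEL provenance of
abc-iut-w6-d073's `δ`-form residue `FundamentalExtension.Lem27iiiStep` (`AbsTopILem27iii.lean`): the lemma
is typed over MATHLIB's continuous representations — the datum "`G_k` acting continuously on `T(B)`" is a
`ContRepresentation Λ G V` (`G →* V →L[Λ] V`; print: `Λ = Ẑ`, e.g. the tree's `AbsTopIII.ZHatCoeff =
∏_p ℤ_p`, `G = G_k`, `V = T(B)`), a quotient `T ↠ R` is a SURJECTIVE `ContIntertwiningMap`, invariant
submodules are `Representation.invtSubmodule`, trivial action is `Representation.IsTrivial`, the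
contragredient `Hom(–, Λ)` is `Representation.dual`, and the augmentation submodule `⟨g v − v⟩` of (i) is
`Representation.Coinvariants.ker` — so the only NEW vocabulary is print's: `FiniteAction` ((ii)(b)),
`NoFiniteActionSubquotient` ((ii)(c)), and the two items themselves.

* (i), (ii) are GEOMETRIC (weights; [AbsAnab] Lemma 1.1.5 "`T^com`") and are recorded as the named
  predicates `Lem27.Lem27i`, `Lem27.Lem27ii` ON THE REPRESENTATION, to be taken BY NAME at `V = T(B)` only
  (FACT policy; for an abstract representation they are plainly false: `G = Ẑ` acting on `V = Ẑ` through
  characters of unbounded finite order on the `ℤ_p`-components has no quotient as in (ii)); the tree has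
  no semi-abelian varieties / Tate modules of varieties (plan/FOUNDATIONS.md), so `T(B)` is not named;
* (iii) is ALGEBRA and is PROVED from (ii)(c) exactly as in print in the proof-only companion
  `AbsTopI/Lem27ModuleProofs.lean` (`Lem27.lem27iii`, via `Lem27.homG_ker_eq_zero` = "`H⁰(G_k, Hom(N, Ẑ))
  = 0`"), in the explicit 1-cochain form «a cochain with values in `Hom(R, Λ)` (`Representation.dual`)
  whose pull-back to `Hom(T, Λ)` is the coboundary of some `t` is itself the coboundary of some `r`» — the
  injectivity of `H¹(G, Hom(R, Λ)) → H¹(G, Hom(T, Λ))` for continuous as well as for abstract cochains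
  (coboundaries of elements are continuous), for every `ℤ`-torsion-free `Λ`.

What the «Lemma 2.7 ⇒ Lem27iiiStep» bridge still needs is recorded in plan/GAP-LEDGER.md (row
G-w5d058g8-2): (i)/(ii) AT the Tate modules of the Albanese varieties of the coverings, the Albanese
identification `Δ_H^{ab-t} ⊗ ℤ_l ≅ T_l(A_H)` with the rank formula of Thm 2.6 (ii) (p0023 l.19–26), and the
Hochschild–Serre edge injection `H¹(G, H¹(Δ, ℚ_l)) ↪ H²(Π, ℚ_l)` (row «LEM27-HS-LOWDEG»).
HONEST FRAMING: [AbsTopI] is a refereed, undisputed paper; STATEMENTS ONLY here; nothing here bears on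
[IUTchIII] Cor. 3.12; typed ≠ proved for (i)(ii).
-/

namespace Literature.AnabelianGeometry.AbsoluteAnabelian.AbsTopI

namespace Lem27

variable {Λ : Type*} [CommRing Λ] {G : Type*} [Group G] [TopologicalSpace G]
  {V : Type*} [AddCommGroup V] [Module Λ V] [TopologicalSpace V] [IsTopologicalAddGroup V]

/-- Lemma 2.7 (ii)(b): "the action of `G_k` on `R` factors through a finite quotient" — some OPEN
subgroup of `G` acts trivially (for profinite `G`, open = closed of finite index).
[cite: MochizukiAbsTopI2012, Lemma 2.7 (ii) p.24] -/
def FiniteAction (π : ContRepresentation Λ G V) : Prop :=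
  ∃ U : Subgroup G, IsOpen (U : Set G) ∧ ∀ g ∈ U, (π.toRepresentation) g = LinearMap.id

/-- Lemma 2.7 (ii)(c) for a submodule `N ⊆ V` (print: `N = Ker(T(B) ↠ R)`): "no nonzero torsion-free
subquotient `S` of the `G_k`-module `N` satisfies the property that the resulting action of `G_k` on `S`
factors through a finite quotient" — for `G`-invariant (`Representation.invtSubmodule`) `N₁ ≤ N₂ ≤ N`
with `N₂/N₁` nonzero and `ℤ`-torsion-free (`N₁` saturated in `N₂`), NO open subgroup of `G` acts
trivially on `N₂/N₁`. [cite: MochizukiAbsTopI2012, Lemma 2.7 (ii) p.24] -/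
def NoFiniteActionSubquotient (π : ContRepresentation Λ G V) (N : Submodule Λ V) : Prop :=
  ∀ N₁ N₂ : Submodule Λ V, N₁ ≤ N₂ → N₂ ≤ N →
    N₁ ∈ (π.toRepresentation).invtSubmodule → N₂ ∈ (π.toRepresentation).invtSubmodule → N₁ ≠ N₂ →
      (∀ (k : ℕ) (x : V), x ∈ N₂ → k ≠ 0 → k • x ∈ N₁ → x ∈ N₁) →
        ¬ ∃ U : Subgroup G, IsOpen (U : Set G) ∧ ∀ g ∈ U, ∀ x ∈ N₂, π g x - x ∈ N₁

universe w in
/-- **[AbsTopI] Lemma 2.7 (i)** as a predicate on the representation: "the maximal torsion-free quotient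
module `T(B) ↠ Q` of `T(B)` on which `G_k` acts trivially is a finitely generated free `Ẑ`-module" —
there is a surjective continuous intertwining map `T ↠ Q` onto a representation with TRIVIAL action
(`Representation.IsTrivial`) whose kernel is the SMALLEST `G`-invariant, `ℤ`-saturated submodule containing
the augmentation submodule `⟨g v − v⟩ = Representation.Coinvariants.ker` (i.e. `Q` is THE maximal
`ℤ`-torsion-free quotient of the coinvariants `Representation.Coinvariants`), and `Q` is free of finite rank
(`Module.Free ∧ Module.Finite`; its carrier in universe `w`).  GEOMETRIC in print ("Riemann hypothesis for
abelian varieties over finite fields", [AbsAnab] Lemma 1.1.5); asserted only at `V = T(B)`.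
[cite: MochizukiAbsTopI2012, Lemma 2.7 (i) p.24] -/
def Lem27i (π : ContRepresentation Λ G V) : Prop :=
  ∃ (W : Type w) (_ : AddCommGroup W) (_ : Module Λ W) (_ : TopologicalSpace W)
    (_ : IsTopologicalAddGroup W) (τ : ContRepresentation Λ G W) (p : ContIntertwiningMap π τ),
    Function.Surjective p.toContinuousLinearMap ∧ (τ.toRepresentation).IsTrivial ∧
    (∀ N : Submodule Λ V, N ∈ (π.toRepresentation).invtSubmodule →
      Representation.Coinvariants.ker (π.toRepresentation) ≤ N →
      (∀ (k : ℕ) (x : V), k ≠ 0 → k • x ∈ N → x ∈ N) →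
        LinearMap.ker (p.toContinuousLinearMap : V →ₗ[Λ] W) ≤ N) ∧
    Module.Free Λ W ∧ Module.Finite Λ W

universe w in
/-- **[AbsTopI] Lemma 2.7 (ii)** as a predicate on the representation: "there exists a quotient
`G_k`-module `T(B) ↠ R` such that (a) `R` is a finitely generated free `Ẑ`-module; (b) the action of `G_k`
on `R` factors through a finite quotient; (c) no nonzero torsion-free subquotient `S` of `N := Ker(T(B) ↠
R)` [has] action of `G_k` [that] factors through a finite quotient" — a surjective continuous intertwining
map `p : T ↠ R` (Mathlib `ContIntertwiningMap`) with (a) `Module.Free ∧ Module.Finite`, (b) `FiniteAction`,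
(c) `NoFiniteActionSubquotient` of `Ker p` (the COMBINATORIAL quotient; its rank `rk R = dim(R_l ⊗ ℚ_l)` is
independent of `l` — the form in which Thm 2.6 (iii) uses it).  GEOMETRIC in print ([AbsAnab] Lemma
1.1.5 "`T^com`"); asserted only at `V = T(B)`. [cite: MochizukiAbsTopI2012, Lemma 2.7 (ii) p.24] -/
def Lem27ii (π : ContRepresentation Λ G V) : Prop :=
  ∃ (W : Type w) (_ : AddCommGroup W) (_ : Module Λ W) (_ : TopologicalSpace W)
    (_ : IsTopologicalAddGroup W) (τ : ContRepresentation Λ G W) (p : ContIntertwiningMap π τ),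
    Function.Surjective p.toContinuousLinearMap ∧ Module.Free Λ W ∧ Module.Finite Λ W ∧
    FiniteAction τ ∧ NoFiniteActionSubquotient π (LinearMap.ker (p.toContinuousLinearMap : V →ₗ[Λ] W))

end Lem27

end Literature.AnabelianGeometry.AbsoluteAnabelian.AbsTopI
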